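import Mathlib
import Literature.Barriers.ABC.IUTDisputedClaim
import Summits.ABC.ABC.Theses.IUTThetaPilot
import Literature.IUT.LogVolume.GenuineLogThetaPerImage
import Summits.ABC.IUTFork.Joshi.ATS1SelfSimilarity
import Summits.ABC.IUTFork.Joshi.ATS1Thm1111Holds

/-!
# MJ-HARVEST seat inv-3 (D-0156 point 3) — Sketch of NEW candidate Props harvested from Joshi's texts
# (KEY pub/abc-iut/wake/KEY-abc-iut-inv-MJ-HARVEST.md), typed against `Literature.Barriers.ABC.IUTDisputedClaim` and the
# campaign objects `Summit.ABC.ABC.Theses.IUTThetaPilot.ThetaPartII` (stmt-ABC-19678) ▸ RESHAPE-4 readings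
# `Literature.IUT.LogVolume.Cor22.Cor312AtDatum` (U) / `Cor22.Cor312PerImageAtDatum` (P).

HONESTY. Every `def … : Prop` below TYPES a sentence Joshi CLAIMS (author-labelled in the docstring); typed ≠ proved ≠ endorsed;
no side is taken on [IUTchIII] Cor. 3.12 (D-0045); nothing here asserts abc / Szpiro; MORATORIUM rq128 untouched (no model-point
application). The few `theorem`s are TYPING NOTES about OUR interface (what the Prop reduces to under a stated hypothesis), never
claims about print. Rows of `HOME/MJ-HARVEST-3.md` cite these decls as `MJ3.<Name>`; everything else in that table is an EXISTING
tree decl cited by FQN.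
-/

namespace Summit.ABC.ABC.Cruxes.ThetaPartII.MJ3

open scoped Classical

/-! ## N1 — [J-2½] arXiv:2305.10398 Thm-Def 11.2.1 (p.70 l.1–40) «arithmetic mutation of an elliptic curve over a number field»
Joshi claims: «there exists a ℚ-automorphism `σ : ℂ_p → ℂ_p` which maps `C/L` to an isomorphic pair `C′/L′` but `σ` does not
preserve `q₁, …, qₙ`»; proof p.70 l.22–36: choose `σ(q_j) = q_j⁻¹` on a transcendence basis containing the (transcendental, Thm 11.1.1)
Tate parameters, so `|q_j|_v = |σ(q_j)|_{ℂ_p} = |q_j⁻¹| > 1` while `|q_j| < 1` — «the Tate periods have mutated non-trivially under σ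
while the isomorphism class of the curve has remained fixed». Rigidity type (R2): two NON-IDENTIFIED copies of the valued field
structure on ONE abstract field ℂ_p. Typed over Mathlib's concrete `PadicComplex` (`ℂ_[p]`), no posited carrier. -/

/-- **MJ3-N1a `PadicComplexNormMutation`** — the core of [J-2½] Thm-Def 11.2.1 as a property of Mathlib's `ℂ_[p]`:
some FIELD automorphism of `ℂ_[p]` moves an element of the open unit disc outside the closed unit disc (hence is not an
isometry and not even norm-equivalent up to a power). Joshi's construction: `σ(q) = q⁻¹` on a transcendence basis.
[claim: Joshi2023ATS2half, status: disputed] -/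
def PadicComplexNormMutation (p : ℕ) [Fact p.Prime] : Prop :=
  ∃ σ : ℂ_[p] ≃+* ℂ_[p], ∃ q : ℂ_[p], ‖q‖ < 1 ∧ 1 < ‖σ q‖

/-- **MJ3-N1b `TateParameterMutation`** — the printed quantifier shape: EVERY transcendental `q` of the open unit disc
(the Tate parameter of a curve with algebraic `j`, transcendental by [J-2½] Thm 11.1.1 = Barré-Sirieix–Diaz–Gramain–Philibert 1996,
a separate Literature fact not typed here) is moved outside the closed unit disc by SOME field automorphism of `ℂ_[p]`.
(`Transcendental ℤ q` is used to avoid an `Algebra ℚ ℂ_[p]` instance search in the sketch; over a char-0 field it is the same notion.)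
[claim: Joshi2023ATS2half, status: disputed] -/
def TateParameterMutation (p : ℕ) [Fact p.Prime] : Prop :=
  ∀ q : ℂ_[p], Transcendental ℤ q → ‖q‖ < 1 → ∃ σ : ℂ_[p] ≃+* ℂ_[p], 1 < ‖σ q‖

/-- Typing note (ours): N1b at any transcendental point of the open disc gives N1a. [folklore] -/
theorem padicComplexNormMutation_of_tate (p : ℕ) [Fact p.Prime]
    (h : TateParameterMutation p) (q : ℂ_[p]) (hq : Transcendental ℤ q) (hq1 : ‖q‖ < 1) :
    PadicComplexNormMutation p := by
  obtain ⟨σ, hσ⟩ := h q hq hq1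
  exact ⟨σ, q, hq1, hσ⟩

/-- Typing note (ours): an automorphism witnessing N1a is NOT norm-preserving — the «mutated» valued field `(ℂ_p, |σ(·)|)` and
`(ℂ_p, |·|)` are two valued-field structures on one field that no identification `x ↦ x` respects (the R2 content AS TYPED).
[folklore] -/
theorem not_norm_preserving_of_mutation (p : ℕ) [Fact p.Prime] {σ : ℂ_[p] ≃+* ℂ_[p]} {q : ℂ_[p]}
    (hq : ‖q‖ < 1) (hσ : 1 < ‖σ q‖) : ¬ ∀ x : ℂ_[p], ‖σ x‖ = ‖x‖ := by
  intro h
  have := h q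
  linarith

/-! ## N2 — [J-2½] §8 (pp. 51–55): heights attached to arithmeticoids, the `L*`-stabilised height, the «height stabilization principle»
Joshi claims: Def 8.2.1 `h_{arith(L)_y}(P) = Σ_v max_j log |x_j|^{α_v}_{K_{y_v}}`; Prop 8.3.1 «the associated height function depends
non-trivially on arith(L)»; Rmk 8.3.2 «the height computed in one may not agree with that in the other»; §8.5/p.54 «the inequality
`h_{n·arith(y₀)} ≥ h_{arith(y₀)}`, which is strict in general … an upper semi-continuity property of heights … creates opportunities in
Diophantine problems where one wants upper bounds on heights»; Def 8.6.1 `h^{stab}_{arith(L)_y}(x) = sup{h_{arith(L)_{α·y}}(x) : α ∈ L*}`;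
Thm 8.7.1 «height stablization principle» `h^{stab} ≥ h` («a trivial consequence of Definition 8.6.1», «In general … strict»);
Rmk 8.8.2 (1) «there is some relationship between the height stabilization principle and some abc-type inequality» (NOT typed: no
statement in print). Rigidity type (R1)+(R3): distinct arithmetic holomorphic structures ⇒ distinct height functions, and a
sup over the `L*`-orbit as the candidate new bound. NOT typed anywhere in `Summits/ABC/IUTFork/Joshi/` (JOSHI-DAG rows J2h:Def8.2.1 …
J2h:Rmk8.8.2 «untyped»). Posited INTERFACE (data only, no instance, no axiom smuggling existence) + separate claim-Props. -/

/-- **MJ3-N2 interface `ArithHeightFamily`** — the data of [J-2½] §8: a parameter space `Y` of arithmeticoids `y` (points of the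
adelic Fargues–Fontaine curve `𝒴_L`, Def 5.1.1), a set `A` of global symmetries acting on it (`L* ↷ 𝒴_L`, Thm 4.2.3 (5), Cor 5.7.1)
by `act`, a type `X` of arguments (points of `ℙⁿ(L̄)` / algebraic numbers) and the height `h y x = h_{arith(L)_y}(x)` of Def 8.2.1.
Pure data: nothing about normalisation or the product formula is built in (those enter as hypotheses below). -/
structure ArithHeightFamily where
  /-- arithmeticoids `y ∈ 𝒴_L` -/
  Y : Type
  /-- the acting symmetries (`α ∈ L*`) -/
  A : Type
  /-- `act α y = α · y` (global Frobenius / Lubin–Tate action, Thm 4.2.3 (5)) -/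
  act : A → Y → Y
  /-- the identity symmetry `1 ∈ L*` (pinned after crit-A's probe P2, 13:11:07Z: with `A := ∅` the bare interface made Thm 8.7.1 false) -/
  one : A
  /-- `1 · y = y` -/
  act_one : ∀ y, act one y = y
  /-- arguments of the height -/
  X : Type
  /-- `h y x = h_{arith(L)_y}(x)` (Def 8.2.1) -/
  h : Y → X → ℝ

namespace ArithHeightFamily

variable (F : ArithHeightFamily)

/-- **Def 8.6.1, typed**: the `L*`-stabilised height `h^{stab}_{arith(L)_y}(x) = sup_α h_{arith(L)_{α·y}}(x)`, valued in `EReal`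
(print takes a `sup` over `α ∈ L*` of real numbers with no boundedness clause; `+∞` is therefore allowed here rather than the junk
value `0` of a real `sSup`). [claim: Joshi2023ATS2half, status: disputed] -/
noncomputable def stabHeight (y : F.Y) (x : F.X) : EReal := ⨆ a : F.A, ((F.h (F.act a y) x : ℝ) : EReal)

/-- **Prop 8.3.1 / Rmk 8.3.2, typed** (R1): «the associated height function depends non-trivially on arith(L)» — two arithmeticoids
and one argument with different heights. [claim: Joshi2023ATS2half, status: disputed] -/
def HeightDependsOnArith : Prop := ∃ y₁ y₂ : F.Y, ∃ x : F.X, F.h y₁ x ≠ F.h y₂ x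

/-- **Thm 8.7.1 «height stablization principle», typed**: `h^{stab}_y(x) ≥ h_y(x)` for all `y, x`.
[claim: Joshi2023ATS2half, status: disputed] -/
def HeightStabilization : Prop := ∀ (y : F.Y) (x : F.X), ((F.h y x : ℝ) : EReal) ≤ F.stabHeight y x

/-- **p.54 l.30–33 / p.55 l.1 «In general, the above inequality is a strict inequality», typed** (R3-candidate: the orbit-sup is a
genuinely larger bound somewhere). [claim: Joshi2023ATS2half, status: disputed] -/
def StabilizationStrict : Prop := ∃ (y : F.Y) (x : F.X), ((F.h y x : ℝ) : EReal) < F.stabHeight y x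

/-- The NORMALISATION clause of Def 8.2.1 read on `L`-RATIONAL arguments (our reading, a hypothesis not a claim): with the «standard
normalization» `|p|_{K_{y_p}} = 1/p` at every place and the product formula (5.3.4), the local factors of `h_{arith(L)_y}` restricted to
`L` are the standard absolute values, so on a set `Xrat` of `L`-rational arguments the height is `act`-invariant. -/
def InvariantOn (Xrat : Set F.X) : Prop := ∀ (a : F.A) (y : F.Y), ∀ x ∈ Xrat, F.h (F.act a y) x = F.h y x

/-- Typing note (ours): Thm 8.7.1 AS TYPED holds outright once the interface carries `1 ∈ L*` (`one`, `act_one`) — print: «a trivial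
consequence of Definition 8.6.1», «its proof is a tautology». [folklore] -/
theorem heightStabilization_holds : F.HeightStabilization := by
  intro y x
  have : ((F.h y x : ℝ) : EReal) = ((F.h (F.act F.one y) x : ℝ) : EReal) := by rw [F.act_one]
  rw [this]
  exact le_iSup (fun a : F.A => ((F.h (F.act a y) x : ℝ) : EReal)) F.one


/-- Typing note (ours): on arguments where the height is `act`-invariant (e.g. `L`-rational points under Def 8.2.1's standard
normalisation) the stabilised height EQUALS the height — there `StabilizationStrict` has no witness; Joshi's «strict in general»
therefore needs arguments outside `Xrat` (points of `ℙⁿ(L̄) ∖ ℙⁿ(L)` read through the arithmeticoid's embedding `L̄ ↪ K_{y_v}`) or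
non-normalised local factors. Located, not adjudicated. [folklore] -/
theorem stabHeight_eq_of_invariantOn {Xrat : Set F.X} (hinv : F.InvariantOn Xrat)
    (y : F.Y) {x : F.X} (hx : x ∈ Xrat) : F.stabHeight y x = ((F.h y x : ℝ) : EReal) := by
  haveI : Nonempty F.A := ⟨F.one⟩
  unfold stabHeight
  have : (fun a : F.A => ((F.h (F.act a y) x : ℝ) : EReal)) = fun _ => ((F.h y x : ℝ) : EReal) := by
    funext a; rw [hinv a y x hx]
  rw [this, iSup_const]

/-- Typing note (ours): … hence no strictness witness inside `Xrat`. [folklore] -/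
theorem not_strict_on_invariant {Xrat : Set F.X} (hinv : F.InvariantOn Xrat)
    (y : F.Y) {x : F.X} (hx : x ∈ Xrat) : ¬ ((F.h y x : ℝ) : EReal) < F.stabHeight y x := by
  rw [F.stabHeight_eq_of_invariantOn hinv y hx]
  exact lt_irrefl _

end ArithHeightFamily

/-! ## N3 — the CONSUMPTION SHAPES the critic tests a surviving candidate against (stated, never asserted)
A harvested Prop `C` «supplies the rigidity the barrier says is missing» for THIS campaign only if it feeds the open RESHAPE-4 residual
(reading (P): `Cor22.Cor312PerImageAtDatum`; reading (U) above the hull regime is refuted as typed, p455039) or `ThetaPartII` itself.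
These two defs only NAME the implication to be tested; no instance of either is claimed for N1/N2 (see MJ-HARVEST-3.md col. «attach»). -/

open Literature.IUT.LogVolume in
/-- «`C` supplies the (P)-reading residual of RESHAPE-4 at every `(P, l)`» — the test shape, not a claim. -/
def SuppliesPerImage (C : Prop) : Prop :=
  C → ∀ (P : Literature.NumberTheory.DiophantineGeometry.GenEll.NFPoint) (l : ℕ), Cor22.Cor312PerImageAtDatum P l

/-- «`C` supplies the crux `ThetaPartII` (stmt-ABC-19678)» — the test shape, not a claim. -/
def SuppliesThetaPartII (C : Prop) : Prop := C → Summit.ABC.ABC.Theses.IUTThetaPilot.ThetaPartII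

/-- Typing note (ours): the barrier declaration is itself an explicit abc-type inequality (`IUTDisputedClaim_iff` pins its casts); a
candidate that supplied `ThetaPartII` would, with the route's two PROVED items, close `_root_.ABC` through the certified `closes` — which
is why the critic's test is «does `C`, AS TYPED, reach `SuppliesThetaPartII C` / `SuppliesPerImage C` non-vacuously», never «is `C` true».
This `example` only records that the barrier decl is in scope of the sketch. [folklore] -/
example : Prop := Literature.Barriers.ABC.IUTDisputedClaim

/-! ## N4 — [J-I] arXiv:2106.11452v4 Thm 11.1.1 / Thm 1.1 (= FAQ 2025 Q18's «K not isomorphic to (ℂ_p, |·|^ν)»), for the record: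
ALREADY typed AND PROVED in the tree as `Summit.ABC.IUTFork.Joshi.ATS1.Thm1111v2` / `thm1111v2_holds` (uncountably many pairwise
inequivalent complete non-archimedean absolute values with `|p| < 1` on any algebraically closed complete `K`; E-t25's docstring notes the
valued fields of Joshi's proof are pull-backs `|σ(−)|` along field automorphisms, ISOMETRIC to `(K, |−|)` via `σ`). Re-exported by name so the
critic can cite one module. RELATION TO N1 (ours, not proved here): a pull-back valuation `‖σ ·‖` inequivalent to `‖·‖` on `ℂ_[p]` yields an
element of one open unit disc outside the other (`AbsoluteValue.isEquiv_iff_lt_one_iff`), i.e. N1a up to replacing `σ` by `σ⁻¹` and `<` by `≤`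
at the boundary — so N1a is the R2-shadow of the SAME construction as [J-I] Thm 11.1.1, not an independent input. -/

/-- [J-I] Thm 11.1.1 at a prime, by name (E-t25 `thm1111v2_holds_of_prime`). [claim: Joshi2021ATS1, status: disputed] -/
theorem thm1111_by_name (p : ℕ) [Fact p.Prime] (K : Type) [Field K] (vK : AbsoluteValue K ℝ) :
    Summit.ABC.IUTFork.Joshi.ATS1.Thm1111v2 p K vK :=
  Summit.ABC.IUTFork.Joshi.ATS1.thm1111v2_holds_of_prime p K vK

end Summit.ABC.ABC.Cruxes.ThetaPartII.MJ3
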